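import Summits.BirchSwinnertonDyer.BirchSwinnertonDyer.Theorems.Rank1ResidualJetConjActPlaceUnramified
import Summits.BirchSwinnertonDyer.Rank1Residual.X11b.KummerRelaxedStructures
import Literature.NumberTheory.GaloisCohomology.Howard2004.FiniteSingularEvaluation
import HarnessLib

/-!
# Route `GenusKolyvaginAtTwo`, crux L_T `PowDvdShaCardAtTwoRT` (stmt-BirchSwinnertonDyer-23242), LINE 18 stub KS, the DROPS, input `hrec` —
# THE UNRAMIFIED PARAMETRISATION `unr : E[p^k] → H¹(K_λ, E[p^k])` AT A DEEP KOLYVAGIN PLACE (hypotheses `unr`, `hunr`, `hunrL`,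
# `hLunr`, `hunr0` of `…RTLocalEigenDuality`, discharged)

Seat `bsd-line-gk2-p3` g23 (PROVER seat 3/3, cell `bsd-f1-sign2`), `--supports stmt-BirchSwinnertonDyer-23242` (helper; closes nothing).
THEOREMS ONLY (no definition, no named fact, no `sorry`).  BSD is NOT proved by any of this; neither is the crux nor any stub.

WHY.  `…RTLocalEigenDuality.addOrderOf_invWeilPairing_unr_eq_of_same_sign` (the order of the surviving terms of Kolyvagin's two-term
reciprocity at `p = 2`, input `hrec` of `PlusDescent.weakSwapOracle_of_twoPrimeReciprocity`) displays an additive, injective parametrisation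
`unr : T → H¹(K_v, E[2^M])` of the local Kummer condition `𝓛_v`, equivariant for an involution `t` of `T` and `σ_* = conjActPlace` on
`H¹`.  THIS FILE constructs it (as an `∃`, no definition) with `T = E[p^k](K̄)` and `t = τ̃_*` the action of the ADAPTED lift
`τ̃ = liftAutPlace τ hfix` — the same lift under which `…RTLocalConjInvariance` proved `inv_v(· ∪ₑ ·)` invariant:
* §1 (any non-archimedean local field `F`, finite module `W` with TRIVIAL `Γ_F`-action, `φ` a Frobenius lift)
  **`exists_unramified_parametrization`** — for an endomorphism `T` of `H¹(F, W)` given on cocycles by `[ψ] ↦ [g ↦ t(ψ(f g))]` with `f`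
  carrying Frobenius to Frobenius and inertia to inertia: there is an injective `unr : W →+ H¹(F, W)` onto `H¹_ur(F, W)` with
  `ev_φ ∘ unr = id` and `unr ∘ t = T ∘ unr` — Howard's `H¹_ur ≅ W` by evaluation (`evalClass_bijective_unramified`, Prop. 1.1.7) inverted,
  plus the Jet cell's `apply_eq_apply_of_isFrobPow` (`ψ(f φ) = ψ(φ)` on unramified `ψ`);
* §2 at a Zhang–Kolyvagin prime `ℓ` of `E/ℚ` with `k ≤ M(ℓ)`, `K` imaginary quadratic, `λ ∋ ℓ`, `τ • λ = λ`:
  **`exists_unramified_parametrization_conjActPlace`** (`T = conjActPlace W τ (p^k) hfix`, `t = τ̃_*`; trivial action by the Jet cell's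
  `galoisRep_toLocal_apply_eq_self`, `f = Θ⁻¹(·)Θ` Frobenius/inertia-preserving by `isFrobPow_conjGalCMH`), and
  **`exists_unramified_parametrization_kummer`** — the same with `H¹_ur` replaced by the Kummer condition
  `(W_K).kummerSelmerStructure (p^k) λ` at the good place `λ ∤ p` (X11b `kummerSelmerStructure_inr_eq_unramifiedSubgroup`), i.e. EXACTLY the
  five `unr`-hypotheses of the order law, with `t = (isLiftOfAut_liftAutPlace τ hfix).torsionMap W (p^k)`.
What is NOT here: that `t` is a REGULAR involution on `E[2^M]` on `Δ < 0` (it acts as `Frob_ℓ ∼ c₀`; the free rank-one `ℤ/2^M[t]`-structure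
`hspan/hfree/htor` of the order law) — next file.

References: [Howard2004HeegnerKolyvagin] Prop. 1.1.7; [Jetchev2008] §3.2 (2); [McCallumLMS1991] §4 Prop. 4.4 (proof: `E_{p^M} ⊂ E(K_λ)`);
[SilvermanAEC2009] Cor. X.4.4; [Kolyvagin1991MathAnn] Thm. 2.1.
-/

set_option autoImplicit false

noncomputable section

open scoped Classical
open Function Field NumberField IsDedekindDomain WeierstrassCurve
open Literature.NumberTheory.EllipticCurves Literature.NumberTheory.GaloisRepresentations
open Literature.NumberTheory.GaloisRepresentations.IsNonarchimedeanLocalField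
open Literature.NumberTheory.GaloisCohomology.Howard2004
open Literature.NumberTheory.Automorphic
open Summit.BirchSwinnertonDyer.Rank1Residual.JET.GlobalDuality

-- the Theorems namespace of this sub repeats the summit name by design (D-0017 nested layout)
set_option linter.dupNamespace false

namespace Summit.BirchSwinnertonDyer.BirchSwinnertonDyer.Theorems.GenusExact.PlusDescent

/-! ## §1 Inverting Howard's `H¹_ur(F, W) ≅ W`, equivariantly -/

section Generic

variable {F : Type} [Field F] [ValuativeRel F] [TopologicalSpace F] [IsNonarchimedeanLocalField F]
variable {W : Type} [AddCommGroup W] [TopologicalSpace W] [DiscreteTopology W] [Finite W]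
  (ρ : DiscreteGaloisModule F W)

/-- **The unramified parametrisation.**  `F` a non-archimedean local field, `W` a finite discrete module with TRIVIAL `Γ_F`-action, `φ` a
Frobenius lift; `T` an endomorphism of `H¹(F, W)` given on cocycles by `[ψ] ↦ [g ↦ t(ψ(f g))]`, `f` carrying `φ` to a Frobenius lift and
`I_F` into `I_F`.  Then there is an additive INJECTIVE `unr : W → H¹(F, W)` with image `H¹_ur(F, W)`, inverse to evaluation at `φ`
(`ev_φ(unr w) = w`), and EQUIVARIANT: `unr(t w) = T(unr w)`. [cite: Howard2004HeegnerKolyvagin, Prop. 1.1.7]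
[cite: Jetchev2008, §3.2 (2)] -/
theorem exists_unramified_parametrization (htriv : ∀ (g : absoluteGaloisGroup F) (w : W), ρ g w = w)
    {φ : absoluteGaloisGroup F} (hφ : IsFrobPow φ 1)
    (T : galoisCohomology ρ 1 →+ galoisCohomology ρ 1) (t : W →+ W) (f : absoluteGaloisGroup F → absoluteGaloisGroup F)
    (hT : ∀ ψ : contOneCocycles ρ.toTopRep, ∃ ψ' : contOneCocycles ρ.toTopRep,
      T (oneCocycleClass ρ.toTopRep ψ) = oneCocycleClass ρ.toTopRep ψ' ∧ ∀ g, ψ'.1 g = t (ψ.1 (f g)))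
    (hf : IsFrobPow (f φ) 1) (hfI : ∀ τ ∈ absInertia F, f τ ∈ absInertia F) :
    ∃ unr : W →+ galoisCohomology ρ 1, Injective unr ∧
      (∀ w, unr w ∈ DiscreteGaloisModule.unramifiedSubgroup ρ 1) ∧
      (∀ c ∈ DiscreteGaloisModule.unramifiedSubgroup ρ 1, ∃ w, unr w = c) ∧
      (∀ w, evalClass ρ htriv φ (unr w) = w) ∧
      (∀ w, unr (t w) = T (unr w)) := by
  set U := DiscreteGaloisModule.unramifiedSubgroup ρ 1 with hU
  -- Howard: evaluation at `φ` is a bijection `U ≃ W`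
  set ev : U →+ W := (evalClass ρ htriv φ).comp U.subtype with hev
  have hbij : Bijective ev := evalClass_bijective_unramified ρ htriv hφ
  set E : U ≃+ W := AddEquiv.ofBijective ev hbij with hE
  have hEapp : ∀ c : U, E c = evalClass ρ htriv φ (c : galoisCohomology ρ 1) := fun c ↦ rfl
  set unr : W →+ galoisCohomology ρ 1 := U.subtype.comp E.symm.toAddMonoidHom with hunr
  have hunr_app : ∀ w, unr w = ((E.symm w : U) : galoisCohomology ρ 1) := fun w ↦ rfl
  have hev_unr : ∀ w, evalClass ρ htriv φ (unr w) = w := fun w ↦ by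
    rw [hunr_app, ← hEapp, AddEquiv.apply_symm_apply]
  -- `T` preserves `U` and `ev_φ ∘ T = t ∘ ev_φ` on `U`
  have hTU : ∀ c ∈ U, T c ∈ U ∧ evalClass ρ htriv φ (T c) = t (evalClass ρ htriv φ c) := by
    intro c hc
    obtain ⟨ψ, rfl⟩ := oneCocycleClass_surjective ρ.toTopRep c
    obtain ⟨ψ', hTψ, hψ'⟩ := hT ψ
    have hψI : ∀ τ ∈ absInertia F, ψ.1 τ = 0 := (mem_unramified_iff_forall_apply_eq_zero ρ htriv ψ).mp hc
    refine ⟨?_, ?_⟩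
    · rw [hTψ]
      exact (mem_unramified_iff_forall_apply_eq_zero ρ htriv ψ').mpr fun τ hτ ↦ by
        rw [hψ', hψI _ (hfI τ hτ), map_zero]
    · rw [hTψ, evalClass_oneCocycleClass, evalClass_oneCocycleClass, hψ', apply_eq_apply_of_isFrobPow ρ htriv hφ hf ψ hψI]
  refine ⟨unr, Subtype.val_injective.comp E.symm.injective, fun w ↦ (E.symm w).2, fun c hc ↦ ⟨E ⟨c, hc⟩, ?_⟩, hev_unr,
    fun w ↦ ?_⟩
  · rw [hunr_app, AddEquiv.symm_apply_apply]
  · -- both sides are unramified with the same value at `φ`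
    obtain ⟨hTmem, hTev⟩ := hTU (unr w) (E.symm w).2
    have h1 : evalClass ρ htriv φ (unr (t w)) = evalClass ρ htriv φ (T (unr w)) := by rw [hev_unr, hTev, hev_unr]
    have h2 := hbij.1 (a₁ := ⟨unr (t w), (E.symm (t w)).2⟩) (a₂ := ⟨T (unr w), hTmem⟩) h1
    exact congrArg Subtype.val h2

end Generic

/-! ## §2 At a deep Kolyvagin place of the Heegner field, for `σ_* = conjActPlace` -/

section Kolyvagin

variable (W : WeierstrassCurve ℚ) (K : Type) [Field K] [NumberField K] [W.IsElliptic] [W.IsGloballyMinimal]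

/-- **The unramified parametrisation at a Zhang–Kolyvagin prime, equivariant for `conjActPlace`.**  `K` imaginary quadratic, `E = W/ℚ`
globally minimal, `ℓ` a Zhang–Kolyvagin prime with `k ≤ M(ℓ)`, `λ ∋ ℓ`, `τ ∈ Aut(K/ℚ)` with `τ • λ = λ`: there is an injective additive
`unr : E[p^k](K̄) → H¹(K_λ, E[p^k])` onto `H¹_ur(K_λ, E[p^k])` with `unr(τ̃_* Q) = σ_{*,λ}(unr Q)` for the adapted lift `τ̃ = liftAutPlace τ hfix`
and `σ_{*,λ} = conjActPlace W τ (p^k) hfix` (Jetchev 2008 §3.2 (2): `τ` acts on `H¹_f(K_λ, E[p^k]) ≅ E[p^k]` through `E[p^k]`).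
[cite: Jetchev2008, §3.2 (2)] [cite: Howard2004HeegnerKolyvagin, Prop. 1.1.7] [cite: McCallumLMS1991, §4 Prop. 4.4] -/
theorem exists_unramified_parametrization_conjActPlace (hK : IsImaginaryQuadratic K) {p : ℕ} [Fact p.Prime]
    {k ℓ : ℕ} (hℓ : Zhang2014.IsKolyvaginPrime (W.conductorNorm ℤ) W K p ℓ) (hk : k ≤ Zhang2014.kolyvaginIndex W p ℓ)
    (w : HeightOneSpectrum (𝓞 K)) (hw : (ℓ : 𝓞 K) ∈ w.asIdeal) (τ : K ≃ₐ[ℚ] K) (hfix : τ • w = w) :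
    ∃ unr : geomTorsion (W.baseChange K) ((p ^ k : ℕ) : ℤ) →+
        galoisCohomology (GaloisRep.toLocal w ((W.baseChange K).torsionGaloisModule ((p ^ k : ℕ) : ℤ))) 1,
      Injective unr ∧
      (∀ Q, unr Q ∈ DiscreteGaloisModule.unramifiedSubgroup
        (GaloisRep.toLocal w ((W.baseChange K).torsionGaloisModule ((p ^ k : ℕ) : ℤ))) 1) ∧
      (∀ c ∈ DiscreteGaloisModule.unramifiedSubgroup
        (GaloisRep.toLocal w ((W.baseChange K).torsionGaloisModule ((p ^ k : ℕ) : ℤ))) 1, ∃ Q, unr Q = c) ∧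
      (∀ Q, unr ((isLiftOfAut_liftAutPlace τ hfix).torsionMap W ((p ^ k : ℕ) : ℤ) Q) =
        conjActPlace W τ ((p ^ k : ℕ) : ℤ) hfix (unr Q)) := by
  have hp : p.Prime := Fact.out
  set L := w.adicCompletion K with hL
  set n : ℤ := ((p ^ k : ℕ) : ℤ) with hn
  haveI : Finite (geomTorsion (W.baseChange K) n) :=
    finite_torsionPoints_holds (W.baseChange K) (AlgebraicClosure K) (by
      rw [hn]; exact_mod_cast pow_ne_zero k hp.ne_zero)
  set ρ := GaloisRep.toLocal w ((W.baseChange K).torsionGaloisModule n) with hρ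
  -- a local Frobenius
  obtain ⟨φ, hφ⟩ := exists_isAbsArithFrob_holds L
  have hφ1 : IsFrobPow φ 1 := IsAbsArithFrob.isFrobPow_holds hφ
  -- the adapted pair
  set hτ := isLiftOfAut_liftAutPlace τ hfix with hτdef
  set hΘ := isLiftOfRingEquiv_ringEquivLift (galAdicCompletionEquiv (L := K) τ hfix) with hΘdef
  set hc := liftsCommute_liftAutPlace τ hfix with hcdef
  -- `conjActPlace` on cocycles: `[ψ] ↦ [g ↦ τ̃_* ψ(Θ⁻¹ g Θ)]`
  have hT : ∀ ψ : contOneCocycles ρ.toTopRep, ∃ ψ' : contOneCocycles ρ.toTopRep,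
      conjActPlace W τ n hfix (oneCocycleClass ρ.toTopRep ψ) = oneCocycleClass ρ.toTopRep ψ' ∧
        ∀ g, ψ'.1 g = hτ.torsionMap W n (ψ.1 (hΘ.conjGalCMH g)) := fun ψ =>
    ⟨contOneCocycles.pullback hΘ.conjGalCMH (localConjHom W hτ hΘ hc n) ψ, localConjH1_oneCocycleClass W hτ hΘ hc n ψ,
      fun g => by rw [contOneCocycles.pullback_apply]; rfl⟩
  -- `Θ⁻¹(·)Θ` preserves the inertia group
  have hfI : ∀ i ∈ absInertia L, hΘ.conjGalCMH i ∈ absInertia L := fun i hi => by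
    rw [← isFrobPow_zero_iff_mem_absInertia] at hi ⊢
    exact isFrobPow_conjGalCMH K τ hfix hΘ hi
  obtain ⟨unr, hinj, hmem, hsurj, -, hequiv⟩ := exists_unramified_parametrization ρ
    (galoisRep_toLocal_apply_eq_self W K hK hℓ hk w hw) hφ1
    (conjActPlace W τ n hfix) (hτ.torsionMap W n) (fun g => hΘ.conjGalCMH g) hT
    (isFrobPow_conjGalCMH K τ hfix hΘ hφ1) hfI
  exact ⟨unr, hinj, hmem, hsurj, hequiv⟩

/-- **The same, onto the local KUMMER condition** (`= H¹_ur` at the good place `λ ∤ p`, X11b `kummerSelmerStructure_inr_eq_unramifiedSubgroup`):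
EXACTLY the five `unr`-hypotheses of `…RTLocalEigenDuality` (`hunr0`, `hunrL`, `hLunr`, `hunr`) at a deep inert Kolyvagin place, with
`T = E[p^k](K̄)`, `t = (isLiftOfAut_liftAutPlace τ hfix).torsionMap W (p^k)`, `σ = conjActPlace W τ (p^k) hfix`.
[cite: SilvermanAEC2009, Cor. X.4.4] [cite: Howard2004HeegnerKolyvagin, Prop. 1.1.7] [cite: Kolyvagin1991MathAnn, Thm. 2.1] -/
theorem exists_unramified_parametrization_kummer (hK : IsImaginaryQuadratic K) {p : ℕ} [Fact p.Prime]
    {k ℓ : ℕ} (hℓ : Zhang2014.IsKolyvaginPrime (W.conductorNorm ℤ) W K p ℓ) (hk : k ≤ Zhang2014.kolyvaginIndex W p ℓ)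
    (w : HeightOneSpectrum (𝓞 K)) (hw : (ℓ : 𝓞 K) ∈ w.asIdeal) (hpw : ((p : ℕ) : 𝓞 K) ∉ w.asIdeal)
    (hgood : (W.baseChange K).HasGoodReductionAt w) (τ : K ≃ₐ[ℚ] K) (hfix : τ • w = w) :
    ∃ unr : geomTorsion (W.baseChange K) ((p ^ k : ℕ) : ℤ) →+
        galoisCohomology (((W.baseChange K).torsionGaloisModule ((p ^ k : ℕ) : ℤ)).toLocal (Sum.inr w : Place K)) 1,
      Injective unr ∧
      (∀ Q, unr Q ∈ (W.baseChange K).kummerSelmerStructure ((p ^ k : ℕ) : ℤ) (Sum.inr w)) ∧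
      (∀ c ∈ (W.baseChange K).kummerSelmerStructure ((p ^ k : ℕ) : ℤ) (Sum.inr w), ∃ Q, unr Q = c) ∧
      (∀ Q, unr ((isLiftOfAut_liftAutPlace τ hfix).torsionMap W ((p ^ k : ℕ) : ℤ) Q) =
        conjActPlace W τ ((p ^ k : ℕ) : ℤ) hfix (unr Q)) := by
  obtain ⟨unr, hinj, hmem, hsurj, hequiv⟩ := exists_unramified_parametrization_conjActPlace W K hK hℓ hk w hw τ hfix
  have hKum := Summit.BirchSwinnertonDyer.Rank1Residual.X11b.KummerPT.kummerSelmerStructure_inr_eq_unramifiedSubgroup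
    (W.baseChange K) p k hpw hgood
  refine ⟨unr, hinj, fun Q ↦ ?_, fun c hc ↦ ?_, hequiv⟩
  · rw [hKum]; exact hmem Q
  · rw [hKum] at hc; exact hsurj c hc

end Kolyvagin

end Summit.BirchSwinnertonDyer.BirchSwinnertonDyer.Theorems.GenusExact.PlusDescent

end
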